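/-
Origin: expansion seat `planner-pub-hodgecm-pv14-g6-0`, handover import Pv14g6.SchwartzStoneVonNeumann -> import HodgeCM.Automorphic.SchwartzStoneVonNeumann (HodgeCM.Automorphic.WeilThetaModelHeisenbergPs landed r28, unchanged) ; after SchwartzStoneVonNeumann (this seat row 1, same run); independent of the three pv14-g5 RUN-29 rows (`HOME/pub-hodgecm-pv14-g6/lean/Pv14g6/SchwartzWeilProjective.lean`, md5 b7806344, 281 lines);
landed by the gen-8 packager in gate run 29 as `HodgeCM/Automorphic/SchwartzWeilProjective.lean` (import ^import Pv14g6\.SchwartzStoneVonNeumann[ \t]*$→import HodgeCM.Automorphic.SchwartzStoneVonNeumann ×1).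
-/
/-
Origin: `pub-hodgecm-pv14-g6/lean/Pv14g6/SchwartzWeilProjective.lean` — session planner-pub-hodgecm-pv14-g6-0
(unit pub-hodgecm-pv14-g6, DAG-node prover #14, gen 6).  Intended final place:
`HodgeCM/Automorphic/SchwartzWeilProjective.lean` (namespace `HodgeCM.SchwartzWeil`).  NEW ADDITIVE LEAF.
PACKAGER: rewrite `import Pv14g6.SchwartzStoneVonNeumann` to `import HodgeCM.Automorphic.SchwartzStoneVonNeumann`
(this seat's HANDOVER #1, RUN 29); the other import is a landed tree module (r28).
Asserts nothing: no axioms, no unproved declarations.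
-/
import Summits.HodgeConjecture.HodgeCM.Automorphic.SchwartzStoneVonNeumann_3
import Summits.HodgeConjecture.HodgeCM.Automorphic.WeilThetaModelHeisenbergPs_2

/-!
# The Weil representation is projective: the intertwining group of `ρ_m` is a central extension by `ℂˣ`

Let `ρ_m = repUnits V m : Heis V →* GL(𝓢(V, ℂ))` be the weight-`m` Schrödinger representation (`m ≠ 0`) of the
Heisenberg group on Schwartz space (landed: `HodgeCM/Automorphic/WeilThetaModelHeisenberg{,Weyl}.lean`).  The
**intertwining group** of `ρ_m` is
`Mp_m(V) = {(γ, R) ∈ Aut(Heis V) × GL(𝓢(V, ℂ)) : ρ_m(γ h) = R ρ_m(h) R⁻¹ for all h}` (`HodgeCM.SchwartzWeil.mpGroup V m`);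
the lineage's intertwining condition `Intertwines V m φ π` for an action `φ : D →* Aut(Heis V)` and operators
`π : D →* GL(𝓢)` (`WeilThetaModelHeisenbergAdjoin`) says exactly that `d ↦ (φ d, π d)` lands in `Mp_m(V)`
(`Intertwines.prodMk_mem_mpGroup`).  From Schur's lemma on `𝓢(V, ℂ)` (`SchwartzStoneVonNeumann`, this seat) we prove:

* `HodgeCM.SchwartzWeil.exists_eq_scalarUnits_of_commute` — a unit of `End 𝓢(V, ℂ)` commuting with `ρ_m` is a scalar
  `κ • 1`, `κ ∈ ℂˣ`;
* `HodgeCM.SchwartzWeil.mem_mpGroup_one_iff` — `(1, R) ∈ Mp_m(V) ↔ R ∈ ℂˣ • 1`: **the kernel of `Mp_m(V) → Aut(Heis V)`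
  is the scalars**, `ker_mpProj_eq_range_mpCenter`, and it is central, `mpCenter_mem_center`: `Mp_m(V)` is a CENTRAL
  EXTENSION of its image in `Aut(Heis V)` by `ℂˣ` — the operator realising a given automorphism is unique up to a scalar
  (`HodgeCM.SchwartzWeil.mpGroup_snd_unique`);
* `HodgeCM.SchwartzWeil.Intertwines.exists_character` — **two intertwining lifts of one action differ by a character**:
  `Intertwines V m φ π → Intertwines V m φ π' → ∃ c : D →* ℂˣ, ∀ d, π' d = (c d • 1) * π d`;
* `HodgeCM.SchwartzWeil.Intertwines.exists_scalar_of_apply_eq_one` — along an intertwining lift, every `d` acting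
  trivially on `Heis V` acts on `𝓢(V, ℂ)` by a scalar (the relations of the acting group hold projectively); in
  particular for the lineage's free lift `psRep` of `⟨weyl, unip⟩` (`WeilThetaModelHeisenbergPs`):
  `psAction m hm w = 1 → ∃ κ : ℂˣ, psRep V m w = κ • 1` (`psRep_eq_scalar_of_psAction_eq_one`).

No operator is constructed here; the existence half (an `R` for every symplectic `γ`) is not addressed.

## References

* A. Weil, *Sur certains groupes d'opérateurs unitaires*, Acta Math. 111 (1964), n° 34–37 (the group of pairs
  `(s, 𝐫)` and its projection to the symplectic group; the kernel is the scalars by irreducibility).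
* G. Lion, M. Vergne, *The Weil representation, Maslov index and theta series*, Progress in Math. 6 (1980), §1.6–1.7.
-/

noncomputable section

open scoped SchwartzMap

namespace HodgeCM
namespace SchwartzWeil

section Scalars

variable (V : Type) [NormedAddCommGroup V] [InnerProductSpace ℝ V] [FiniteDimensional ℝ V] [MeasurableSpace V]
  [BorelSpace V] (m : ℤ)

/-- `𝓢(V, ℂ)` is non-trivial (it contains a bump). -/
instance nontrivial_schwartz : Nontrivial 𝓢(V, ℂ) := by
  obtain ⟨Φ, hΦ⟩ := exists_schwartz_apply_zero_eq_one (V := V)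
  refine ⟨⟨Φ, 0, fun h => ?_⟩⟩
  have h0 : Φ 0 = 0 := by rw [h]; rfl
  rw [hΦ] at h0
  exact one_ne_zero h0

/-- The scalar units `κ • 1` of `End 𝓢(V, ℂ)`. -/
def scalarUnits : ℂˣ →* (𝓢(V, ℂ) →L[ℂ] 𝓢(V, ℂ))ˣ :=
  Units.map (algebraMap ℂ (𝓢(V, ℂ) →L[ℂ] 𝓢(V, ℂ))).toMonoidHom

omit [FiniteDimensional ℝ V] [MeasurableSpace V] [BorelSpace V] in
/-- (Ported verbatim from the HodgeCMPerL package; no docstring in the source.) -/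
@[simp] theorem val_scalarUnits (κ : ℂˣ) :
    (scalarUnits V κ : 𝓢(V, ℂ) →L[ℂ] 𝓢(V, ℂ)) = (κ : ℂ) • (1 : 𝓢(V, ℂ) →L[ℂ] 𝓢(V, ℂ)) := by
  simp [scalarUnits, Algebra.algebraMap_eq_smul_one]

omit [FiniteDimensional ℝ V] [MeasurableSpace V] [BorelSpace V] in
/-- (Ported verbatim from the HodgeCMPerL package; no docstring in the source.) -/
theorem val_scalarUnits_apply (κ : ℂˣ) (Φ : 𝓢(V, ℂ)) :
    (scalarUnits V κ : 𝓢(V, ℂ) →L[ℂ] 𝓢(V, ℂ)) Φ = (κ : ℂ) • Φ := by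
  rw [val_scalarUnits]; rfl

omit [MeasurableSpace V] [BorelSpace V] in
/-- (Ported verbatim from the HodgeCMPerL package; no docstring in the source.) -/
theorem scalarUnits_injective : Function.Injective (scalarUnits V) := by
  intro κ κ' h
  obtain ⟨Φ, hΦ⟩ := exists_ne (0 : 𝓢(V, ℂ))
  have h1 := congrArg (fun R : (𝓢(V, ℂ) →L[ℂ] 𝓢(V, ℂ))ˣ => (R : 𝓢(V, ℂ) →L[ℂ] 𝓢(V, ℂ)) Φ) h
  simp only [val_scalarUnits_apply] at h1
  exact Units.ext (smul_left_injective ℂ hΦ h1)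

omit [FiniteDimensional ℝ V] [MeasurableSpace V] [BorelSpace V] in
/-- Scalars commute with everything. -/
theorem scalarUnits_mul_comm (κ : ℂˣ) (R : (𝓢(V, ℂ) →L[ℂ] 𝓢(V, ℂ))ˣ) :
    scalarUnits V κ * R = R * scalarUnits V κ := by
  refine Units.ext ?_
  simp only [Units.val_mul, val_scalarUnits, smul_mul_assoc, one_mul, mul_smul_comm, mul_one]

/-- **Schur's lemma, units form**: a unit of `End 𝓢(V, ℂ)` commuting with the Schrödinger representation `ρ_m`
(`m ≠ 0`) is a scalar. -/
theorem exists_eq_scalarUnits_of_commute (hm : m ≠ 0) (R : (𝓢(V, ℂ) →L[ℂ] 𝓢(V, ℂ))ˣ)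
    (hR : ∀ h : Heis V, R * repUnits V m h = repUnits V m h * R) : ∃ κ : ℂˣ, R = scalarUnits V κ := by
  have hc : ∀ h : Heis V, (R : 𝓢(V, ℂ) →L[ℂ] 𝓢(V, ℂ)).comp (repCLM V m h) =
      (repCLM V m h).comp (R : 𝓢(V, ℂ) →L[ℂ] 𝓢(V, ℂ)) := fun h => by
    have h1 := congrArg (fun U : (𝓢(V, ℂ) →L[ℂ] 𝓢(V, ℂ))ˣ => (U : 𝓢(V, ℂ) →L[ℂ] 𝓢(V, ℂ))) (hR h)
    simpa only [Units.val_mul, ContinuousLinearMap.mul_def, val_repUnits] using h1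
  obtain ⟨κ, hκ⟩ := exists_eq_smul_id_of_commute_repCLM hm (R : 𝓢(V, ℂ) →L[ℂ] 𝓢(V, ℂ)) hc
  have hκ0 : κ ≠ 0 := by
    rintro rfl
    obtain ⟨Φ, hΦ⟩ := exists_ne (0 : 𝓢(V, ℂ))
    have h1 : ((R⁻¹ * R : (𝓢(V, ℂ) →L[ℂ] 𝓢(V, ℂ))ˣ) : 𝓢(V, ℂ) →L[ℂ] 𝓢(V, ℂ)) Φ = Φ := by
      rw [inv_mul_cancel]; rfl
    rw [Units.val_mul, ContinuousLinearMap.mul_def, ContinuousLinearMap.comp_apply, hκ, zero_smul,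
      zero_apply, map_zero] at h1
    exact hΦ h1.symm
  refine ⟨Units.mk0 κ hκ0, Units.ext ?_⟩
  rw [hκ, val_scalarUnits, Units.val_mk0, ContinuousLinearMap.one_def]

end Scalars

/-! ## The intertwining group `Mp_m(V)` -/

section Mp

variable (V : Type) [NormedAddCommGroup V] [InnerProductSpace ℝ V] [FiniteDimensional ℝ V] [MeasurableSpace V]
  [BorelSpace V] (m : ℤ)

/-- **The intertwining group** `Mp_m(V) = {(γ, R) : ρ_m(γ h) = R ρ_m(h) R⁻¹ ∀ h}` of the weight-`m` Schrödinger
representation, a subgroup of `Aut(Heis V) × GL(𝓢(V, ℂ))`. -/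
def mpGroup : Subgroup (MulAut (Heis V) × (𝓢(V, ℂ) →L[ℂ] 𝓢(V, ℂ))ˣ) where
  carrier := {p | ∀ h : Heis V, repUnits V m (p.1 h) = p.2 * repUnits V m h * p.2⁻¹}
  one_mem' := fun h => by simp
  mul_mem' := by
    intro p q hp hq h
    simp only [Prod.fst_mul, Prod.snd_mul, MulAut.mul_apply, mul_inv_rev]
    rw [hp (q.1 h), hq h]
    simp only [mul_assoc]
  inv_mem' := by
    intro p hp h
    simp only [Prod.fst_inv, Prod.snd_inv, inv_inv]
    have h1 := hp (p.1⁻¹ h)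
    rw [MulAut.apply_inv_self] at h1
    rw [h1]
    group

variable {V m}

/-- (Ported verbatim from the HodgeCMPerL package; no docstring in the source.) -/
theorem mem_mpGroup_iff (p : MulAut (Heis V) × (𝓢(V, ℂ) →L[ℂ] 𝓢(V, ℂ))ˣ) :
    p ∈ mpGroup V m ↔ ∀ h : Heis V, repUnits V m (p.1 h) = p.2 * repUnits V m h * p.2⁻¹ := Iff.rfl

/-- The lineage's intertwining condition says that `d ↦ (φ d, π d)` lands in `Mp_m(V)`. -/
theorem Intertwines.prodMk_mem_mpGroup {D : Type} [Group D] {φ : D →* MulAut (Heis V)}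
    {π : D →* (𝓢(V, ℂ) →L[ℂ] 𝓢(V, ℂ))ˣ} (hc : Intertwines V m φ π) (d : D) : (φ d, π d) ∈ mpGroup V m :=
  fun h => hc d h

/-- (Ported verbatim from the HodgeCMPerL package; no docstring in the source.) -/
theorem intertwines_iff_forall_mem_mpGroup {D : Type} [Group D] (φ : D →* MulAut (Heis V))
    (π : D →* (𝓢(V, ℂ) →L[ℂ] 𝓢(V, ℂ))ˣ) : Intertwines V m φ π ↔ ∀ d, (φ d, π d) ∈ mpGroup V m := Iff.rfl

/-- The generators of the lineage's model lie in `Mp_m(V)`: `(weylAut, 𝓕)` and `(unip 2, chirp m)`. -/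
theorem psGen_mem_mpGroup (hm : m ≠ 0) (g : PsGen) : (Heis.psGenAut m hm g, psGenUnit V m g) ∈ mpGroup V m :=
  fun h => repUnits_psGenAut V m hm g h

variable (V m)

/-- The projection `Mp_m(V) → Aut(Heis V)`. -/
def mpProj : mpGroup V m →* MulAut (Heis V) := (MonoidHom.fst _ _).comp (mpGroup V m).subtype

/-- (Ported verbatim from the HodgeCMPerL package; no docstring in the source.) -/
@[simp] theorem mpProj_apply (p : mpGroup V m) : mpProj V m p = p.val.1 := rfl

/-- Scalars commute with `ρ_m`, so `(1, κ • 1) ∈ Mp_m(V)`. -/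
theorem one_scalarUnits_mem_mpGroup (κ : ℂˣ) : ((1 : MulAut (Heis V)), scalarUnits V κ) ∈ mpGroup V m := by
  intro h
  simp only [MulAut.one_apply]
  rw [scalarUnits_mul_comm, mul_assoc, mul_inv_cancel, mul_one]

/-- The central scalars `ℂˣ → Mp_m(V)`, `κ ↦ (1, κ • 1)`. -/
def mpCenter : ℂˣ →* mpGroup V m where
  toFun κ := ⟨((1 : MulAut (Heis V)), scalarUnits V κ), one_scalarUnits_mem_mpGroup V m κ⟩
  map_one' := Subtype.ext (by simp)
  map_mul' κ κ' := Subtype.ext (by simp)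

/-- (Ported verbatim from the HodgeCMPerL package; no docstring in the source.) -/
@[simp] theorem coe_mpCenter (κ : ℂˣ) :
    (mpCenter V m κ : MulAut (Heis V) × (𝓢(V, ℂ) →L[ℂ] 𝓢(V, ℂ))ˣ) = (1, scalarUnits V κ) := rfl

/-- (Ported verbatim from the HodgeCMPerL package; no docstring in the source.) -/
theorem mpCenter_injective : Function.Injective (mpCenter V m) := fun κ κ' h =>
  scalarUnits_injective V (by simpa using congrArg (fun q : mpGroup V m => q.val.2) h)

/-- The scalars are central in `Mp_m(V)`. -/
theorem mpCenter_mem_center (κ : ℂˣ) : mpCenter V m κ ∈ Subgroup.center (mpGroup V m) := by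
  rw [Subgroup.mem_center_iff]
  intro p
  refine Subtype.ext (Prod.ext ?_ ?_)
  · simp
  · simp only [Subgroup.coe_mul, coe_mpCenter, Prod.snd_mul]
    exact (scalarUnits_mul_comm V κ _).symm

variable {V m}

/-- **The kernel of `Mp_m(V) → Aut(Heis V)` is the scalars** (`m ≠ 0`): `(1, R) ∈ Mp_m(V) ↔ R = κ • 1`. -/
theorem mem_mpGroup_one_iff (hm : m ≠ 0) (R : (𝓢(V, ℂ) →L[ℂ] 𝓢(V, ℂ))ˣ) :
    ((1 : MulAut (Heis V)), R) ∈ mpGroup V m ↔ ∃ κ : ℂˣ, R = scalarUnits V κ := by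
  constructor
  · intro hR
    refine exists_eq_scalarUnits_of_commute V m hm R fun h => ?_
    have h1 : repUnits V m h = R * repUnits V m h * R⁻¹ := by simpa using hR h
    calc R * repUnits V m h = (R * repUnits V m h * R⁻¹) * R := by group
      _ = repUnits V m h * R := by rw [← h1]
  · rintro ⟨κ, rfl⟩
    exact one_scalarUnits_mem_mpGroup V m κ

/-- **`Mp_m(V)` is a central extension of its image by `ℂˣ`**: `ker (Mp_m(V) → Aut(Heis V)) = ℂˣ` (`m ≠ 0`). -/
theorem ker_mpProj_eq_range_mpCenter (hm : m ≠ 0) : (mpProj V m).ker = (mpCenter V m).range := by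
  ext ⟨⟨γ, R⟩, hmem⟩
  simp only [MonoidHom.mem_ker, MonoidHom.mem_range, mpProj_apply]
  constructor
  · rintro rfl
    obtain ⟨κ, hκ⟩ := (mem_mpGroup_one_iff hm R).1 hmem
    exact ⟨κ, Subtype.ext (Prod.ext rfl hκ.symm)⟩
  · rintro ⟨κ, hκ⟩
    have h := congrArg (fun q : mpGroup V m => q.val.1) hκ
    simpa using h.symm

/-- (Ported verbatim from the HodgeCMPerL package; no docstring in the source.) -/
theorem ker_mpProj_le_center (hm : m ≠ 0) : (mpProj V m).ker ≤ Subgroup.center (mpGroup V m) := by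
  rw [ker_mpProj_eq_range_mpCenter hm]
  rintro _ ⟨κ, rfl⟩
  exact mpCenter_mem_center V m κ

/-- **Uniqueness of the operator up to a scalar**: two elements of `Mp_m(V)` over the same automorphism differ by a
scalar (`m ≠ 0`). -/
theorem mpGroup_snd_unique (hm : m ≠ 0) {γ : MulAut (Heis V)} {R R' : (𝓢(V, ℂ) →L[ℂ] 𝓢(V, ℂ))ˣ}
    (hR : (γ, R) ∈ mpGroup V m) (hR' : (γ, R') ∈ mpGroup V m) : ∃ κ : ℂˣ, R' = scalarUnits V κ * R := by
  have hmem : ((1 : MulAut (Heis V)), R' * R⁻¹) ∈ mpGroup V m := by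
    have h := (mpGroup V m).mul_mem hR' ((mpGroup V m).inv_mem hR)
    simpa using h
  obtain ⟨κ, hκ⟩ := (mem_mpGroup_one_iff hm _).1 hmem
  exact ⟨κ, by rw [← hκ, inv_mul_cancel_right]⟩

end Mp

/-! ## Intertwining lifts: unique up to a character; the acting group's relations hold projectively -/

section Lifts

variable {V : Type} [NormedAddCommGroup V] [InnerProductSpace ℝ V] [FiniteDimensional ℝ V] [MeasurableSpace V]
  [BorelSpace V] {m : ℤ} {D : Type} [Group D] {φ : D →* MulAut (Heis V)}
  {π π' : D →* (𝓢(V, ℂ) →L[ℂ] 𝓢(V, ℂ))ˣ}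

/-- **Along an intertwining lift, the kernel of the action acts by scalars** (`m ≠ 0`): if `φ d = 1` then
`π d = κ • 1`.  (The relations of `φ(D) ≤ Aut(Heis V)` hold in `GL(𝓢)` up to scalars: the lift is PROJECTIVE.) -/
theorem Intertwines.exists_scalar_of_apply_eq_one (hm : m ≠ 0) (hc : Intertwines V m φ π) {d : D}
    (hd : φ d = 1) : ∃ κ : ℂˣ, π d = scalarUnits V κ :=
  (mem_mpGroup_one_iff hm _).1 (hd ▸ hc.prodMk_mem_mpGroup d)

/-- **Two intertwining lifts of the same action differ by a character** `c : D →* ℂˣ` (`m ≠ 0`). -/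
theorem Intertwines.exists_character (hm : m ≠ 0) (hc : Intertwines V m φ π) (hc' : Intertwines V m φ π') :
    ∃ c : D →* ℂˣ, ∀ d : D, π' d = scalarUnits V (c d) * π d := by
  have key : ∀ d : D, ∃ κ : ℂˣ, π' d = scalarUnits V κ * π d := fun d =>
    mpGroup_snd_unique hm (hc.prodMk_mem_mpGroup d) (hc'.prodMk_mem_mpGroup d)
  choose c hcd using key
  have hc_eq : ∀ d, scalarUnits V (c d) = π' d * (π d)⁻¹ := fun d => by
    rw [hcd d, mul_inv_cancel_right]
  have hmul : ∀ d e : D, c (d * e) = c d * c e := by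
    intro d e
    have h3 : π' (d * e) = scalarUnits V (c d * c e) * π (d * e) := by
      rw [map_mul π', hcd d, hcd e, map_mul π, map_mul (scalarUnits V), mul_assoc (scalarUnits V (c d)) (π d),
        ← mul_assoc (π d), ← scalarUnits_mul_comm V (c e) (π d)]
      simp only [mul_assoc]
    apply scalarUnits_injective V
    rw [hc_eq, h3, mul_inv_cancel_right]
  exact ⟨MonoidHom.mk' c hmul, fun d => hcd d⟩

variable (V m) in
/-- For the lineage's free lift `psRep` of `⟨weyl, unip⟩`: a word acting trivially on `Heis V` acts on `𝓢(V, ℂ)`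
by a scalar (`m ≠ 0`).  (The landed `WeilThetaModelHeisenbergPresentation` computes this kernel exactly; the present
statement needs no presentation and holds verbatim for any family of intertwined generators.) -/
theorem psRep_eq_scalar_of_psAction_eq_one (hm : m ≠ 0) {w : FreeGroup PsGen}
    (hw : Heis.psAction (V := V) m hm w = 1) :
    ∃ κ : ℂˣ, psRep V m w = scalarUnits V κ :=
  (intertwines_psRep V m hm).exists_scalar_of_apply_eq_one hm hw

end Lifts

end SchwartzWeil
end HodgeCM

end
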